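import Mathlib
import Literature.MathematicalPhysics.QuantumLattice.WilsonDiracAP
import Summits.QuantumFields.QCD.Theorems.QuarksAsStableActionCriticalLineDiamagnetismStubOneLoopMarginOfAux
import Summits.QuantumFields.QCD.Theorems.WilsonQuarkChessboardFlatCellOptimalStubTangentDeltaBAllN

/-!
# The one-loop margin from the tadpole, the cell inequalities and the Hessian margin — auxiliary
algebra, `N` colours
(helper for crux stmt-QuantumFields-9307 `FlatCellOptimal`, line `registered`, stub
`stub_localNormGain_of` (G4 transport), sub-goal `stub_oneLoopMarginOfAuxAllN` — the `Fin 3 ↦ Fin N`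
port of the sibling crux stmt-QuantumFields-9734's `…CriticalLineDiamagnetismStubOneLoopMarginOfAux`,
wave 12)

What.  The small general facts used by the P6 assembly `oneLoopMargin_of` (tadpole + tiling
combinatorics + unitary cell inequalities + bilinear bounds + Hessian margin ⇒ one-loop cell margin),
now for colour `Fin N`, ANY `N : ℕ`:
* `U(N)` matrix algebra of the tiling perturbation `E = W − 1` and of its anti-Hermitian part
  `Y = (E − Eᴴ)/2`: `Yᴴ = −Y` (`conjTranspose_half_sub`), the anti-Hermitian part of `Eᴴ` is `−Y`
  (`half_sub_conjTranspose_of`), `W⁻¹ − 1 = (W − 1)ᴴ` on `U(N)` (`coe_inv_sub_one`);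
* the colour traces `S_μ = Σ_x tr (W(x,μ) − 1)` of a `U(N)` link field on the `2⁴` block with the
  tiling symmetry `W(x + μ̂, μ) = W(x, μ)⁻¹` are REAL (`sum_trace_sub_one_im`), with real part minus
  the link deficit, `Re S_μ = −Σ_x (N − Re tr W(x,μ))` (`sum_trace_sub_one_re`);
* the Frobenius norm of the `N`-colour test field `tst_μ = (1/N)·1` on the link `(0, μ)` is `1/N`
  (`tst_norm_sq`; `= 0` at `N = 0` by `1/0 = 0`);
* the registered sub-goal `stub_oneLoopMarginOfAuxAllN` packages the STRUCTURE OF THE TILING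
  PERTURBATION consumed by the assembly (its steps C(i)/(1)): for `W : Edge 4 2 → U(N)` with
  `W(x + μ̂, μ) = W(x, μ)⁻¹`, `E = W − 1`, `Y = (E − Eᴴ)/2`: `Y` is anti-Hermitian and tiling-odd
  (`Y(x + μ̂, μ) = −Y(x, μ)`), `Im S_μ(E) = 0` and `Re S_μ(E) = −D_μ`.
The perturbation identity `D[u·X] − D[u] = Δ(X − 1)` (`wilsonDirac_dir_sub_eq`, `rep_mul_sub`,
`rep_mul_inv_sub`) is the landed `N`-colour one of `…FlatCellOptimal.TangentDelta`
(`…StubTangentDeltaBAllN`), and the colour-FREE lemmas of the sibling file (`re_trace_add_mul_add`,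
`sum_edge_eq_sum_dir`, `inv_le`, `inv_sqrt_le`, `le_sqrt_self`, `mixed_le` and the real bookkeeping
`bookkeeping` = the sibling's registered `stub_oneLoopMarginOfAux`, which is `N`-free and is reused
verbatim by the all-`N` assembly) are re-EXPORTED into `…OneLoop.OneLoopMarginOf` (aliases, no
restatement).

How.  Textual port `3 ↦ N` of the sibling proofs: `tr 1 = N` (`Matrix.trace_one`, `Fintype.card_fin`),
`tr Xᴴ = conj (tr X)`, reindexing `x ↦ x + μ̂` on `(ℤ/2)⁴`.
References: Montvay–Münster, *Quantum Fields on a Lattice* §4.2 (Wilson fermions); folklore linear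
algebra.  Pure theorem file (no `def`s).
-/

noncomputable section

open scoped BigOperators Classical Matrix ComplexConjugate
open Finset
open Literature.MathematicalPhysics.QuantumLattice Literature.MathematicalPhysics.QuantumFieldTheory
  Literature.Probability.LatticeModels

namespace Summit.QuantumFields.QCD.Cruxes.FlatCellOptimal.OneLoop

namespace OneLoopMarginOf

/-! ### Colour-free lemmas of the sibling file and the `N`-colour perturbation identity, re-exported -/

export Summit.QuantumFields.QCD.Cruxes.CriticalLineDiamagnetism.ChessboardCellGain.OneLoopMarginOf
  (re_trace_add_mul_add sum_edge_eq_sum_dir inv_le inv_sqrt_le le_sqrt_self mixed_le bookkeeping)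

export Summit.QuantumFields.QCD.Cruxes.FlatCellOptimal.TangentDelta
  (wilsonDirac_dir_sub_apply rep_mul_sub rep_mul_inv_sub wilsonDirac_dir_sub_eq)

variable {N : ℕ}

/-! ### `N × N` matrix algebra -/

/-- The anti-Hermitian part `(A − Aᴴ)/2` is anti-Hermitian (`N` colours). -/
theorem conjTranspose_half_sub (A : Matrix (Fin N) (Fin N) ℂ) :
    ((1 / 2 : ℂ) • (A - Aᴴ))ᴴ = -((1 / 2 : ℂ) • (A - Aᴴ)) := by
  -- adapted from the sibling `OneLoopMarginOf.conjTranspose_half_sub` (`Fin 3 ↦ Fin N`)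
  rw [Matrix.conjTranspose_smul, Matrix.conjTranspose_sub, Matrix.conjTranspose_conjTranspose,
    ← smul_neg, neg_sub]
  congr 1
  simp

/-- The anti-Hermitian part of `Aᴴ` is minus that of `A` (`N` colours). -/
theorem half_sub_conjTranspose_of (A : Matrix (Fin N) (Fin N) ℂ) :
    (1 / 2 : ℂ) • (Aᴴ - Aᴴᴴ) = -((1 / 2 : ℂ) • (A - Aᴴ)) := by
  -- adapted from the sibling `OneLoopMarginOf.half_sub_conjTranspose_of` (`Fin 3 ↦ Fin N`)
  rw [Matrix.conjTranspose_conjTranspose, ← smul_neg, neg_sub]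

/-- `W⁻¹ − 1 = (W − 1)ᴴ` on `U(N)`. -/
theorem coe_inv_sub_one (W : Matrix.unitaryGroup (Fin N) ℂ) :
    (((W⁻¹ : Matrix.unitaryGroup (Fin N) ℂ)) : Matrix (Fin N) (Fin N) ℂ) - 1 =
      (((W : Matrix (Fin N) (Fin N) ℂ)) - 1)ᴴ := by
  -- adapted from the sibling `OneLoopMarginOf.coe_inv_sub_one` (`Fin 3 ↦ Fin N`)
  rw [Matrix.UnitaryGroup.inv_val, Matrix.conjTranspose_sub, Matrix.conjTranspose_one,
    Matrix.star_eq_conjTranspose]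

/-! ### Colour traces on the `2⁴` block -/

/-- If `W(x + μ̂, μ) = W(x, μ)⁻¹` then `S_μ = Σ_x tr (W(x,μ) − 1)` is real (`N` colours). -/
theorem sum_trace_sub_one_im (W : Edge 4 2 → Matrix.unitaryGroup (Fin N) ℂ) (μ : Fin 4)
    (hW : ∀ x : TorusSite 4 2, W (Site.shift x μ, μ) = (W (x, μ))⁻¹) :
    (∑ x : TorusSite 4 2,
      ((((W (x, μ) : Matrix.unitaryGroup (Fin N) ℂ)) : Matrix (Fin N) (Fin N) ℂ) - 1).trace).im = 0 := by
  -- adapted from the sibling `OneLoopMarginOf.sum_trace_sub_one_im` (`Fin 3 ↦ Fin N`)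
  have h1 : ∑ x : TorusSite 4 2,
      ((((W (x, μ) : Matrix.unitaryGroup (Fin N) ℂ)) : Matrix (Fin N) (Fin N) ℂ) - 1).trace =
      ∑ x : TorusSite 4 2, ((((W (Site.shift x μ, μ) : Matrix.unitaryGroup (Fin N) ℂ)) :
        Matrix (Fin N) (Fin N) ℂ) - 1).trace :=
    (Equiv.sum_comp (Equiv.addRight (Pi.single μ (1 : ZMod 2))) (fun x : TorusSite 4 2 =>
      ((((W (x, μ) : Matrix.unitaryGroup (Fin N) ℂ)) : Matrix (Fin N) (Fin N) ℂ) - 1).trace)).symm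
  have h2 : ∀ x : TorusSite 4 2, ((((W (Site.shift x μ, μ) : Matrix.unitaryGroup (Fin N) ℂ)) :
      Matrix (Fin N) (Fin N) ℂ) - 1).trace =
      conj (((((W (x, μ) : Matrix.unitaryGroup (Fin N) ℂ)) : Matrix (Fin N) (Fin N) ℂ) - 1).trace) := by
    intro x
    rw [hW x, coe_inv_sub_one, Matrix.trace_conjTranspose, Complex.star_def]
  rw [← Complex.conj_eq_iff_im, map_sum]
  conv_rhs => rw [h1]
  exact (Finset.sum_congr rfl fun x _ => (h2 x).symm)

/-- `Re S_μ = −Σ_x (N − Re tr W(x,μ))` (`N` colours). -/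
theorem sum_trace_sub_one_re (W : Edge 4 2 → Matrix.unitaryGroup (Fin N) ℂ) (μ : Fin 4) :
    (∑ x : TorusSite 4 2,
      ((((W (x, μ) : Matrix.unitaryGroup (Fin N) ℂ)) : Matrix (Fin N) (Fin N) ℂ) - 1).trace).re =
      -∑ x : TorusSite 4 2,
        ((N : ℝ) - ((((W (x, μ) : Matrix.unitaryGroup (Fin N) ℂ)) : Matrix (Fin N) (Fin N) ℂ)).trace.re) := by
  -- adapted from the sibling `OneLoopMarginOf.sum_trace_sub_one_re` (`3 ↦ N`)
  rw [Complex.re_sum, ← Finset.sum_neg_distrib]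
  refine Finset.sum_congr rfl fun x _ => ?_
  rw [Matrix.trace_sub, Matrix.trace_one, Complex.sub_re, Fintype.card_fin, Complex.natCast_re]
  ring

/-- The Frobenius norm of the `N`-colour test field `tst_μ = (1/N)·1` on the link `(0, μ)` is `1/N`
(both sides vanish at `N = 0`). -/
theorem tst_norm_sq (μ : Fin 4) :
    ∑ e : Edge 4 2, ∑ a : Fin N, ∑ b : Fin N,
      ‖(if e = ((0 : TorusSite 4 2), μ) then (1 / (N : ℂ)) • (1 : Matrix (Fin N) (Fin N) ℂ) else 0)
        a b‖ ^ 2 = 1 / N := by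
  -- adapted from the sibling `OneLoopMarginOf.tst_norm_sq` (`1/3 ↦ 1/N`)
  rw [Finset.sum_eq_single ((0 : TorusSite 4 2), μ) (fun e _ he => by simp [if_neg he]) (by simp)]
  simp only [if_true, Matrix.smul_apply, Matrix.one_apply, smul_eq_mul, mul_ite, mul_one, mul_zero]
  have h : ∀ a : Fin N, ∑ b : Fin N, ‖(if a = b then (1 / (N : ℂ)) else 0)‖ ^ 2 = 1 / (N : ℝ) ^ 2 := by
    intro a
    rw [Finset.sum_eq_single a (fun b _ hb => by rw [if_neg (Ne.symm hb)]; simp) (by simp)]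
    simp
  rw [Finset.sum_congr rfl fun a _ => h a, Finset.sum_const, Finset.card_univ, Fintype.card_fin,
    nsmul_eq_mul]
  rcases Nat.eq_zero_or_pos N with hN | hN
  · subst hN; simp
  · have hN' : (N : ℝ) ≠ 0 := by exact_mod_cast hN.ne'
    field_simp

/-! ### The structure of the tiling perturbation -/

/-- **Anti-Hermitian part of the tiling perturbation.**  For `W(x + μ̂, μ) = W(x, μ)⁻¹` on `U(N)`,
`E = W − 1`, `Y = (E − Eᴴ)/2`: `E(x + μ̂, μ) = E(x, μ)ᴴ`, `Y` is anti-Hermitian and tiling-odd. -/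
theorem antiHermitian_odd (W : Edge 4 2 → Matrix.unitaryGroup (Fin N) ℂ)
    (E Y : Edge 4 2 → Matrix (Fin N) (Fin N) ℂ)
    (hE : ∀ e, E e = ((W e : Matrix.unitaryGroup (Fin N) ℂ) : Matrix (Fin N) (Fin N) ℂ) - 1)
    (hY : ∀ e, Y e = (1 / 2 : ℂ) • (E e - (E e)ᴴ))
    (hW : ∀ (x : TorusSite 4 2) (μ : Fin 4), W (Site.shift x μ, μ) = (W (x, μ))⁻¹) :
    (∀ (x : TorusSite 4 2) (μ : Fin 4), E (Site.shift x μ, μ) = (E (x, μ))ᴴ) ∧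
    (∀ e, (Y e)ᴴ = -Y e) ∧
    (∀ (x : TorusSite 4 2) (μ : Fin 4), Y (Site.shift x μ, μ) = -Y (x, μ)) := by
  -- adapted from steps `hYanti`, `hEsh`, `hYodd` of the sibling assembly `stub_oneLoopMargin_of`
  have hEsh : ∀ (x : TorusSite 4 2) (μ : Fin 4), E (Site.shift x μ, μ) = (E (x, μ))ᴴ := by
    intro x μ
    rw [hE, hE, hW x μ, coe_inv_sub_one]
  refine ⟨hEsh, fun e => ?_, fun x μ => ?_⟩
  · rw [hY]; exact conjTranspose_half_sub (E e)
  · rw [hY, hY, hEsh, half_sub_conjTranspose_of]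

end OneLoopMarginOf

/-- **Sub-goal `stub_oneLoopMarginOfAuxAllN` (G4 port, wave 12) — the structure of the tiling
perturbation, `N` colours.**  For a `U(N)` link field `W` on the `2⁴` block with the tiling symmetry
`W(x + μ̂, μ) = W(x, μ)⁻¹`, its perturbation `E = W − 1` and anti-Hermitian part `Y = (E − Eᴴ)/2`
(given by their defining equations): (i) `Y` is anti-Hermitian; (ii) `Y` is tiling-odd,
`Y(x + μ̂, μ) = −Y(x, μ)`; (iii) the colour traces `S_μ(E) = Σ_x tr E(x, μ)` are real; (iv)
`Re S_μ(E) = −Σ_x (N − Re tr W(x, μ))` (minus the link deficit in direction `μ`).  These are the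
`N`-dependent inputs C(i)/(1) of the all-`N` P6 assembly `oneLoopMargin_of`; its real bookkeeping is the
sibling's `N`-free `stub_oneLoopMarginOfAux` (re-exported as `OneLoopMarginOf.bookkeeping`). -/
theorem stub_oneLoopMarginOfAuxAllN : ∀ (N : ℕ) (W : Edge 4 2 → Matrix.unitaryGroup (Fin N) ℂ) (E Y : Edge 4 2 → Matrix (Fin N) (Fin N) ℂ), (∀ e, E e = ((W e : Matrix.unitaryGroup (Fin N) ℂ) : Matrix (Fin N) (Fin N) ℂ) - 1) → (∀ e, Y e = (1 / 2 : ℂ) • (E e - (E e)ᴴ)) → (∀ (x : TorusSite 4 2) (μ : Fin 4), W (Site.shift x μ, μ) = (W (x, μ))⁻¹) → (∀ e, (Y e)ᴴ = -Y e) ∧ (∀ (x : TorusSite 4 2) (μ : Fin 4), Y (Site.shift x μ, μ) = -Y (x, μ)) ∧ (∀ μ : Fin 4, (∑ x : TorusSite 4 2, (E (x, μ)).trace).im = 0) ∧ (∀ μ : Fin 4, (∑ x : TorusSite 4 2, (E (x, μ)).trace).re = -∑ x : TorusSite 4 2, ((N : ℝ) - ((W (x, μ) : Matrix.unitaryGroup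 (Fin N) ℂ) : Matrix (Fin N) (Fin N) ℂ).trace.re)) := by
  intro N W E Y hE hY hW
  obtain ⟨-, hYanti, hYodd⟩ := OneLoopMarginOf.antiHermitian_odd W E Y hE hY hW
  have hEfun : E = fun e => ((W e : Matrix.unitaryGroup (Fin N) ℂ) : Matrix (Fin N) (Fin N) ℂ) - 1 :=
    funext hE
  refine ⟨hYanti, hYodd, fun μ => ?_, fun μ => ?_⟩
  · rw [hEfun]; exact OneLoopMarginOf.sum_trace_sub_one_im W μ fun x => hW x μ
  · rw [hEfun]; exact OneLoopMarginOf.sum_trace_sub_one_re W μ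

end Summit.QuantumFields.QCD.Cruxes.FlatCellOptimal.OneLoop

end
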